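import Mathlib.RingTheory.MvPolynomial.WeightedHomogeneous
import Mathlib.RingTheory.FiniteType
import Mathlib.RingTheory.RegularLocalRing.Polynomial
import Mathlib.Algebra.Order.Antidiag.Finsupp
import Mathlib.Algebra.MonoidAlgebra.MapDomain
import Mathlib.Algebra.MonoidAlgebra.Basic
import Mathlib.RingTheory.Localization.Away.Basic
import Mathlib.Data.Int.Cast.Lemmas
import Mathlib.Algebra.Group.Nat.Hom
import Literature.AlgebraicGeometry.Resolution.AffineBlowupAlgebra
import Literature.AlgebraicGeometry.Resolution.AffineBlowup
import HarnessLib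

/-!
# Cone programme: the chart of `Bl_{SM} C(ℙᵃ⁻¹ × ℙᵇ⁻¹)` at `xᵢ₀yⱼ₀` is an affine `(a+b-1)`-space

Support file for crux stmt-ResolutionOfSingularities-15317 (`FrobeniusLadder.FRationalResolution`), line `redirect`,
CONE PROGRAMME (rung 4′ in all dimensions on the Veronese cones and on the Segre cones `Spec k[xᵢyⱼ]`).
Registered stub `stub_segre_chart_isRegularRing`.

Let `A = SR[a,b] = k[xᵢyⱼ] ⊆ P = k[x₁,…,x_a,y₁,…,y_b]` be the Segre ring, `SM ⊆ A` its vertex ideal (spanned by the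
`xᵢyⱼ`) and `g = xᵢ₀yⱼ₀`. The affine blowup algebra `B = A[SM/g] ⊆ L = A[1/g]` (image model, `blowupAlgebra`) is the
polynomial ring `k[g, xᵢ/xᵢ₀ (i ≠ i₀), yⱼ/yⱼ₀ (j ≠ j₀)]` in `a + b - 1` variables, indexed by
`σ = {v : Fin a ⊕ Fin b // v ≠ inl i₀}` (`inr j₀ ↦ g`, `inl i ↦ xᵢ/xᵢ₀ := (xᵢyⱼ₀)/g`, `inr j ↦ yⱼ/yⱼ₀ := (xᵢ₀yⱼ)/g`):
the ring map `ψ : k[T_v : v ∈ σ] → B` with these values is SURJECTIVE (`B` is generated over `A` by the `xᵢyⱼ/g`,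
and the quadric relations `(xᵢyⱼ)(xᵢ₀yⱼ₀) = (xᵢyⱼ₀)(xᵢ₀yⱼ)` give `xᵢyⱼ = g · (xᵢ/xᵢ₀)(yⱼ/yⱼ₀)`,
`xᵢyⱼ/g = (xᵢ/xᵢ₀)(yⱼ/yⱼ₀)` in `L`, with `xᵢ₀/xᵢ₀ = 1`) and INJECTIVE (`g` is a unit of the Laurent ring
`k[ℤ^{a+b}] ⊇ P ⊇ A`, so `A ⊆ k[ℤ^{a+b}]` extends to `λ : L → k[ℤ^{a+b}]`, and `λ ∘ ψ` is the monomial map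
`k[ℕ^σ] → k[ℤ^{a+b}]` along the additive exponent map `θ`, `θ(ε_{inl i}) = ε_{inl i} − ε_{inl i₀}`,
`θ(ε_{inr j}) = ε_{inr j} − ε_{inr j₀}` (`j ≠ j₀`), `θ(ε_{inr j₀}) = ε_{inl i₀} + ε_{inr j₀}`, which has an explicit additive
retraction, hence is injective). Hence `B ≅ k[T_v : v ∈ σ]` is regular (`IsRegularRing.of_ringEquiv`). All folklore
(Kollár, *Lectures on resolution of singularities* (2007), §2.2; Fulton, *Introduction to toric varieties*, §2.6;
Bruns–Herzog 1998 §6.1); only Mathlib and the tree's `div_mem_blowupAlgebra` are used (template: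
`…VeroneseChartRegular.lean`); no named facts. -/

-- single-problem summit: the doubled namespace component is forced
set_option linter.dupNamespace false

noncomputable section

namespace Summit.ResolutionOfSingularities.ResolutionOfSingularities.Theorems.FRationalResolution

open MvPolynomial
open Literature.AlgebraicGeometry.Resolution

section Cones

variable (k : Type) [Field k]

/-- The polynomial ring in two blocks of `a` and `b` variables `xᵢ = X (inl i)`, `yⱼ = X (inr j)`. -/
local notation3 "SP[" a ", " b "]" => MvPolynomial (Fin a ⊕ Fin b) k

/-- The Segre ring `k[xᵢyⱼ] ⊆ k[x, y]`: coordinate ring of the affine cone over the Segre embedding of `ℙᵃ⁻¹ × ℙᵇ⁻¹`.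
(Same term as the `SR[a, b]` of the sibling cone-programme files; the named arguments `(R := k) (σ := Fin a ⊕ Fin b)` of
`MvPolynomial.X` only make each leaf fully determined at once, which keeps the instance problems
`Algebra ↥SR[a, b] (Localization.Away g)` of the theorem headers below within the default heartbeats.) -/
local notation3 "SR[" a ", " b "]" =>
  Algebra.adjoin k (Set.range (fun ij : Fin a × Fin b =>
    (MvPolynomial.X (R := k) (σ := Fin a ⊕ Fin b) (Sum.inl ij.1) *
      MvPolynomial.X (R := k) (σ := Fin a ⊕ Fin b) (Sum.inr ij.2) : MvPolynomial (Fin a ⊕ Fin b) k)))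

/-- The vertex ideal of the Segre cone: spanned by the generators `xᵢyⱼ`. -/
local notation3 "SM[" a ", " b "]" =>
  Ideal.span {v : ↥SR[a, b] | ∃ ij : Fin a × Fin b,
    (v : MvPolynomial (Fin a ⊕ Fin b) k) = MvPolynomial.X (Sum.inl ij.1) * MvPolynomial.X (Sum.inr ij.2)}

/-- The Laurent polynomial ring `k[ℤ^{a+b}]` (coordinate ring of the `(a+b)`-torus). -/
local notation3 "LR[" a ", " b "]" => AddMonoidAlgebra k (Fin a ⊕ Fin b →₀ ℤ)

/-- The structure map `A → A[1/g]`, `A = SR[a,b]`. -/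
local notation3 "AL[" a ", " b ", " g "]" => algebraMap (↥SR[a, b]) (Localization.Away g)

/-- The generator `xᵢyⱼ` lies in the Segre ring. [folklore] -/
theorem segreChart_X_mul_X_mem (a b : ℕ) (i : Fin a) (j : Fin b) : (X (Sum.inl i) * X (Sum.inr j) : SP[a, b]) ∈ SR[a, b] :=
  Algebra.subset_adjoin ⟨(i, j), rfl⟩

/-- The generator `xᵢyⱼ` as an element of the Segre ring `SR[a,b]`. -/
local notation3 "SG[" a ", " b ", " i ", " j "]" =>
  (⟨MvPolynomial.X (Sum.inl i) * MvPolynomial.X (Sum.inr j), segreChart_X_mul_X_mem k a b i j⟩ : ↥SR[a, b])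

/-- The generator `xᵢyⱼ` lies in the vertex ideal `SM[a,b]`. [folklore] -/
theorem segreChart_gen_mem_SM (a b : ℕ) (i : Fin a) (j : Fin b) : SG[a, b, i, j] ∈ SM[a, b] :=
  Ideal.subset_span ⟨(i, j), rfl⟩

/-- **Generation of `A[SM/g]` over `A`.** A subring `T ⊆ A[1/g]` (`A = SR[a,b]`) containing the image of `A` and the
fractions `xᵢyⱼ/g` contains `A[SM/g]`: it is generated over `A` by the `v/g`, `v ∈ SM`, `v ↦ v/g` is `A`-linear, and
`SM` is spanned by the `xᵢyⱼ`. [folklore] -/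
theorem segreChart_mem_of_mem_blowupAlgebra (a b : ℕ) (g : ↥SR[a, b]) (T : Subring (Localization.Away g))
    (hA : ∀ s : ↥SR[a, b], AL[a, b, g] s ∈ T)
    (hgen : ∀ (v : ↥SR[a, b]) (i : Fin a) (j : Fin b), (v : SP[a, b]) = X (Sum.inl i) * X (Sum.inr j) →
      AL[a, b, g] v * IsLocalization.Away.invSelf g ∈ T)
    {w : Localization.Away g} (hw : w ∈ blowupAlgebra SM[a, b] g) : w ∈ T := by
  induction hw using Algebra.adjoin_induction with
  | mem w hw =>
    obtain ⟨v, hv, rfl⟩ := hw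
    induction hv using Submodule.span_induction with
    | mem v hv =>
      obtain ⟨⟨i, j⟩, hvd⟩ := hv
      exact hgen v i j hvd
    | zero => simpa only [map_zero, zero_mul] using T.zero_mem
    | add v v' _ _ hv hv' => simpa only [map_add, add_mul] using T.add_mem hv hv'
    | smul c v _ hv => simpa only [smul_eq_mul, map_mul, mul_assoc] using T.mul_mem (hA c) hv
  | algebraMap s => exact hA s
  | add w₁ w₂ _ _ hw₁ hw₂ => exact T.add_mem hw₁ hw₂
  | mul w₁ w₂ _ _ hw₁ hw₂ => exact T.mul_mem hw₁ hw₂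

/-- **The Segre quadric relations** `(xᵢyⱼ)(xᵢ₀yⱼ₀) = (xᵢyⱼ₀)(xᵢ₀yⱼ)` in `A = SR[a,b]`. [folklore] -/
theorem segreChart_gen_mul_gen (a b : ℕ) (i₀ : Fin a) (j₀ : Fin b) (g : ↥SR[a, b])
    (hg : (g : SP[a, b]) = X (Sum.inl i₀) * X (Sum.inr j₀)) (v : ↥SR[a, b]) (i : Fin a) (j : Fin b)
    (hv : (v : SP[a, b]) = X (Sum.inl i) * X (Sum.inr j)) : v * g = SG[a, b, i, j₀] * SG[a, b, i₀, j] := by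
  apply Subtype.ext
  rw [Subalgebra.coe_mul, Subalgebra.coe_mul, hv, hg]
  ring

/-- **`xᵢyⱼ = g · (xᵢ/xᵢ₀) · (yⱼ/yⱼ₀)` in `A[1/g]`** (`g = xᵢ₀yⱼ₀`; `xᵢ/xᵢ₀ := (xᵢyⱼ₀)/g`, `yⱼ/yⱼ₀ := (xᵢ₀yⱼ)/g`): the
quadric relation divided by `g²`. [folklore] -/
theorem segreChart_algebraMap_gen (a b : ℕ) (i₀ : Fin a) (j₀ : Fin b) (g : ↥SR[a, b])
    (hg : (g : SP[a, b]) = X (Sum.inl i₀) * X (Sum.inr j₀)) (v : ↥SR[a, b]) (i : Fin a) (j : Fin b)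
    (hv : (v : SP[a, b]) = X (Sum.inl i) * X (Sum.inr j)) :
    AL[a, b, g] v = AL[a, b, g] g * (AL[a, b, g] SG[a, b, i, j₀] * IsLocalization.Away.invSelf g) *
      (AL[a, b, g] SG[a, b, i₀, j] * IsLocalization.Away.invSelf g) := by
  have key := segreChart_gen_mul_gen k a b i₀ j₀ g hg v i j hv
  set f := AL[a, b, g]
  set u := IsLocalization.Away.invSelf (S := Localization.Away g) g
  have hinv : f g * u = 1 := IsLocalization.Away.mul_invSelf g
  calc f v = f v * (f g * u) * (f g * u) := by rw [hinv, mul_one, mul_one]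
    _ = f (v * g) * f g * u * u := by rw [map_mul]; ring
    _ = f g * (f SG[a, b, i, j₀] * u) * (f SG[a, b, i₀, j] * u) := by rw [key, map_mul]; ring

/-- **The image of `A` is reached.** For `A = SR[a,b]` and `g = xᵢ₀yⱼ₀`, a subring `T ⊆ A[1/g]` containing the image of
`k`, the element `g` and the fractions `xᵢ/xᵢ₀ = (xᵢyⱼ₀)/g`, `yⱼ/yⱼ₀ = (xᵢ₀yⱼ)/g` contains the image of `A`: `A` is
generated over `k` by the `xᵢyⱼ = g · (xᵢ/xᵢ₀) · (yⱼ/yⱼ₀)`. [folklore] -/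
theorem segreChart_algebraMap_mem (a b : ℕ) (i₀ : Fin a) (j₀ : Fin b) (g : ↥SR[a, b])
    (hg : (g : SP[a, b]) = X (Sum.inl i₀) * X (Sum.inr j₀)) (T : Subring (Localization.Away g))
    (hC : ∀ c : k, AL[a, b, g] (algebraMap k (↥SR[a, b]) c) ∈ T) (h₀ : AL[a, b, g] g ∈ T)
    (hx : ∀ i : Fin a, AL[a, b, g] SG[a, b, i, j₀] * IsLocalization.Away.invSelf g ∈ T)
    (hy : ∀ j : Fin b, AL[a, b, g] SG[a, b, i₀, j] * IsLocalization.Away.invSelf g ∈ T) (s : ↥SR[a, b]) :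
    AL[a, b, g] s ∈ T := by
  obtain ⟨s, hs⟩ := s
  induction hs using Algebra.adjoin_induction with
  | mem s hs =>
    obtain ⟨⟨i, j⟩, rfl⟩ := hs
    generalize_proofs hmem
    rw [segreChart_algebraMap_gen k a b i₀ j₀ g hg ⟨_, hmem⟩ i j rfl]
    exact T.mul_mem (T.mul_mem h₀ (hx i)) (hy j)
  | algebraMap c => exact hC c
  | add s t _ _ hs ht => have hst := T.add_mem hs ht; rwa [← map_add] at hst
  | mul s t _ _ hs ht => have hst := T.mul_mem hs ht; rwa [← map_mul] at hst

/-- **Injectivity by the torus embedding.** Let `A = SR[a,b]`, `g = xᵢ₀yⱼ₀`, `σ = {v : Fin a ⊕ Fin b // v ≠ inl i₀}` and let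
`φ : k[T_v : v ∈ σ] → A[1/g]` be a ring map with `φ c = c`, `φ T_{inr j₀} = g`, `φ T_{inl i} = (xᵢyⱼ₀)/g` (`i ≠ i₀`),
`φ T_{inr j} = (xᵢ₀yⱼ)/g` (`j ≠ j₀`). Then `φ` is injective: `g = χ^{ε_{inl i₀} + ε_{inr j₀}}` is a unit of the Laurent ring
`k[ℤ^{a+b}]`, so `A ⊆ k[x,y] ⊆ k[ℤ^{a+b}]` extends to `λ : A[1/g] → k[ℤ^{a+b}]` (`IsLocalization.Away.lift`), and `λ ∘ φ` is
the monomial map `k[ℕ^σ] → k[ℤ^{a+b}]` (`AddMonoidAlgebra.mapDomain`) along the additive exponent map `θ`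
(`ε_{inl i} ↦ ε_{inl i} − ε_{inl i₀}`, `ε_{inr j} ↦ ε_{inr j} − ε_{inr j₀}` (`j ≠ j₀`), `ε_{inr j₀} ↦ ε_{inl i₀} + ε_{inr j₀}`), which
is injective because it has the additive retraction `π` (`ε_{inl i₀} ↦ 0`, `ε_{inl i} ↦ ε_{inl i}`, `ε_{inr j₀} ↦ ε_{inr j₀}`,
`ε_{inr j} ↦ ε_{inr j} + ε_{inr j₀}`). [folklore] -/
theorem segreChart_injective (a b : ℕ) (i₀ : Fin a) (j₀ : Fin b) (g : ↥SR[a, b])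
    (hg : (g : SP[a, b]) = X (Sum.inl i₀) * X (Sum.inr j₀))
    (φ : MvPolynomial {v : Fin a ⊕ Fin b // v ≠ Sum.inl i₀} k →+* Localization.Away g)
    (hφC : ∀ c, φ (C c) = AL[a, b, g] (algebraMap k (↥SR[a, b]) c))
    (hφg : φ (X ⟨Sum.inr j₀, Sum.inr_ne_inl⟩) = AL[a, b, g] g)
    (hφx : ∀ (i : Fin a) (hi : (Sum.inl i : Fin a ⊕ Fin b) ≠ Sum.inl i₀),
      φ (X ⟨Sum.inl i, hi⟩) = AL[a, b, g] SG[a, b, i, j₀] * IsLocalization.Away.invSelf g)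
    (hφy : ∀ j : Fin b, j ≠ j₀ →
      φ (X ⟨Sum.inr j, Sum.inr_ne_inl⟩) = AL[a, b, g] SG[a, b, i₀, j] * IsLocalization.Away.invSelf g) :
    Function.Injective φ := by
  classical
  -- the cast of exponents `ℕ^{a+b} → ℤ^{a+b}` and the Laurent embedding `Λ : A → k[ℤ^{a+b}]`
  let ι : (Fin a ⊕ Fin b →₀ ℕ) →+ (Fin a ⊕ Fin b →₀ ℤ) := Finsupp.mapRange.addMonoidHom (Nat.castAddMonoidHom ℤ)
  have hιs : ∀ (i : Fin a) (j : Fin b), ι (Finsupp.single (Sum.inl i) 1 + Finsupp.single (Sum.inr j) 1) =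
      Finsupp.single (Sum.inl i) (1 : ℤ) + Finsupp.single (Sum.inr j) 1 := by
    intro i j
    simp only [ι, map_add, Finsupp.mapRange.addMonoidHom_apply, Finsupp.mapRange_single, Nat.coe_castAddMonoidHom, Nat.cast_one]
  let Λ : ↥SR[a, b] →+* LR[a, b] := (AddMonoidAlgebra.mapDomainRingHom k ι).comp (SR[a, b]).val.toRingHom
  have hΛ : ∀ s : ↥SR[a, b], Λ s = AddMonoidAlgebra.mapDomain ι (s : SP[a, b]) := fun s => rfl
  have hΛgen : ∀ (i : Fin a) (j : Fin b),
      Λ SG[a, b, i, j] = AddMonoidAlgebra.single (Finsupp.single (Sum.inl i) (1 : ℤ) + Finsupp.single (Sum.inr j) 1) 1 := by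
    intro i j
    -- `xᵢyⱼ = χ^{ε_{inl i} + ε_{inr j}}` (cf. `segreMemIff_X_mul_X_eq_monomial` of `…SegreMemIff.lean`)
    have hm : (X (Sum.inl i) * X (Sum.inr j) : SP[a, b]) = monomial (Finsupp.single (Sum.inl i) 1 + Finsupp.single (Sum.inr j) 1) 1 := by
      rw [← pow_one (X (Sum.inl i) : SP[a, b]), ← pow_one (X (Sum.inr j) : SP[a, b]), X_pow_eq_monomial, X_pow_eq_monomial,
        monomial_mul, one_mul]
    rw [hΛ, Subtype.coe_mk, hm, ← single_eq_monomial, AddMonoidAlgebra.mapDomain_single, hιs]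
  have hg' : g = SG[a, b, i₀, j₀] := Subtype.ext hg
  have hΛg : Λ g = AddMonoidAlgebra.single (Finsupp.single (Sum.inl i₀) (1 : ℤ) + Finsupp.single (Sum.inr j₀) 1) 1 := by
    rw [hg']; exact hΛgen i₀ j₀
  have hunit : IsUnit (Λ g) := by
    rw [hΛg]
    refine IsUnit.of_mul_eq_one
      (AddMonoidAlgebra.single (-(Finsupp.single (Sum.inl i₀) (1 : ℤ) + Finsupp.single (Sum.inr j₀) 1)) (1 : k)) ?_
    rw [AddMonoidAlgebra.single_mul_single, mul_one, AddMonoidAlgebra.one_def, add_neg_cancel]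
  -- the extension `λ : A[1/g] → k[ℤ^{a+b}]` of `Λ`
  have hlift : ∀ s : ↥SR[a, b], IsLocalization.Away.lift (S := Localization.Away g) g hunit (AL[a, b, g] s) = Λ s :=
    fun s => IsLocalization.Away.lift_eq g hunit s
  have hinv : Λ g * IsLocalization.Away.lift (S := Localization.Away g) g hunit (IsLocalization.Away.invSelf g) = 1 := by
    rw [← hlift g, ← map_mul, IsLocalization.Away.mul_invSelf, map_one]
  -- the exponent vectors `w v` of the images of the variables and the exponent map `θ`
  let w : {v : Fin a ⊕ Fin b // v ≠ Sum.inl i₀} → (Fin a ⊕ Fin b →₀ ℤ) := fun v =>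
    Sum.elim (fun i => Finsupp.single (Sum.inl i) (1 : ℤ) - Finsupp.single (Sum.inl i₀) 1)
      (fun j => if j = j₀ then Finsupp.single (Sum.inl i₀) (1 : ℤ) + Finsupp.single (Sum.inr j₀) 1
        else Finsupp.single (Sum.inr j) (1 : ℤ) - Finsupp.single (Sum.inr j₀) 1) v.1
  let θ : ({v : Fin a ⊕ Fin b // v ≠ Sum.inl i₀} →₀ ℕ) →+ (Fin a ⊕ Fin b →₀ ℤ) :=
    Finsupp.liftAddHom fun v => multiplesHom _ (w v)
  have hθ1 : ∀ v, θ (Finsupp.single v 1) = w v := by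
    intro v
    rw [Finsupp.liftAddHom_apply_single, multiplesHom_apply, one_smul]
  -- the retraction `π` of `θ` (`π ∘ θ` is the cast `ℕ^σ → ℤ^σ`), whence `θ` is injective
  let c : Fin a ⊕ Fin b → ({v : Fin a ⊕ Fin b // v ≠ Sum.inl i₀} →₀ ℤ) :=
    Sum.elim (fun i => if h : i = i₀ then 0 else Finsupp.single ⟨Sum.inl i, fun e => h (Sum.inl_injective e)⟩ 1)
      (fun j => Finsupp.single ⟨Sum.inr j, Sum.inr_ne_inl⟩ 1 +
        if j = j₀ then 0 else Finsupp.single ⟨Sum.inr j₀, Sum.inr_ne_inl⟩ 1)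
  let π : (Fin a ⊕ Fin b →₀ ℤ) →+ ({v : Fin a ⊕ Fin b // v ≠ Sum.inl i₀} →₀ ℤ) :=
    Finsupp.liftAddHom fun u => zmultiplesHom _ (c u)
  have hπ1 : ∀ u, π (Finsupp.single u 1) = c u := by
    intro u
    rw [Finsupp.liftAddHom_apply_single, zmultiplesHom_apply, one_smul]
  have hπw : ∀ v, π (w v) = Finsupp.single v 1 := by
    rintro ⟨v, hv⟩
    rcases v with i | j
    · have hi : i ≠ i₀ := fun e => hv (by rw [e])
      simp [w, c, hπ1, hi]
    · by_cases hj : j = j₀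
      · subst hj
        simp [w, c, hπ1]
      · simp [w, c, hπ1, hj]
  have hπθ : π.comp θ = Finsupp.mapRange.addMonoidHom (Nat.castAddMonoidHom ℤ) := by
    refine Finsupp.addHom_ext fun v n => ?_
    rw [AddMonoidHom.comp_apply, Finsupp.mapRange.addMonoidHom_apply, Finsupp.mapRange_single,
      show Finsupp.single v n = n • Finsupp.single v 1 by rw [Finsupp.smul_single, smul_eq_mul, mul_one],
      map_nsmul, map_nsmul, hθ1, hπw, Finsupp.smul_single]
    simp
  have hθ : Function.Injective θ := by
    intro e e' h
    have h' := congrArg π h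
    rw [← AddMonoidHom.comp_apply, ← AddMonoidHom.comp_apply, hπθ] at h'
    exact Finsupp.mapRange_injective _ (by simp) Nat.cast_injective h'
  -- `λ ∘ φ` is the monomial map along `θ`
  have hcomp : (IsLocalization.Away.lift (S := Localization.Away g) g hunit).comp φ = AddMonoidAlgebra.mapDomainRingHom k θ := by
    refine MvPolynomial.ringHom_ext (fun r => ?_) (fun v => ?_)
    · rw [RingHom.comp_apply, hφC, hlift, hΛ, Subalgebra.coe_algebraMap, MvPolynomial.algebraMap_eq,
        AddMonoidAlgebra.mapDomainRingHom_apply, C_apply, C_apply, ← single_eq_monomial, ← single_eq_monomial,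
        AddMonoidAlgebra.mapDomain_single, AddMonoidAlgebra.mapDomain_single, map_zero, map_zero]
    · obtain ⟨v, hv⟩ := v
      have hR : AddMonoidAlgebra.mapDomainRingHom k θ (X ⟨v, hv⟩) = AddMonoidAlgebra.single (w ⟨v, hv⟩) 1 := by
        rw [AddMonoidAlgebra.mapDomainRingHom_apply, MvPolynomial.X, ← single_eq_monomial, AddMonoidAlgebra.mapDomain_single, hθ1]
      rw [hR, RingHom.comp_apply]
      rcases v with i | j
      · -- `Λ (xᵢyⱼ₀) = χ^{w v} · Λ g`, i.e. `ε_{inl i} + ε_{inr j₀} = (ε_{inl i} − ε_{inl i₀}) + (ε_{inl i₀} + ε_{inr j₀})`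
        have hmj : Λ SG[a, b, i, j₀] = AddMonoidAlgebra.single (w ⟨Sum.inl i, hv⟩) 1 * Λ g := by
          rw [hΛg, AddMonoidAlgebra.single_mul_single, mul_one, hΛgen]
          congr 1
          simp only [w, Sum.elim_inl]
          abel
        rw [hφx i hv, map_mul, hlift, hmj, mul_assoc, hinv, mul_one]
      · by_cases hj : j = j₀
        · subst hj
          rw [hφg, hlift, hΛg]
          congr 1
          simp [w]
        · have hmj : Λ SG[a, b, i₀, j] = AddMonoidAlgebra.single (w ⟨Sum.inr j, hv⟩) 1 * Λ g := by
            rw [hΛg, AddMonoidAlgebra.single_mul_single, mul_one, hΛgen]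
            congr 1
            simp only [w, Sum.elim_inr, if_neg hj]
            abel
          rw [hφy j hj, map_mul, hlift, hmj, mul_assoc, hinv, mul_one]
  refine Function.Injective.of_comp (f := IsLocalization.Away.lift (S := Localization.Away g) g hunit) ?_
  rw [← RingHom.coe_comp, hcomp]
  exact AddMonoidAlgebra.mapDomain_injective hθ

set_option maxHeartbeats 400000 in
/-- **The chart parametrisation is bijective.** For `A = SR[a,b]`, `g = xᵢ₀yⱼ₀`, a ring map `ψ : k[T_v : v ≠ inl i₀] → A[SM/g]`
with `ψ c = c`, `ψ T_{inr j₀} = g`, `ψ T_{inl i} = (xᵢyⱼ₀)/g` (`i ≠ i₀`), `ψ T_{inr j} = (xᵢ₀yⱼ)/g` (`j ≠ j₀`) is bijective: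
injective by the torus embedding (`segreChart_injective` for `ψ` followed by `A[SM/g] ⊆ A[1/g]`), surjective by generation
(`segreChart_mem_of_mem_blowupAlgebra`, `segreChart_algebraMap_mem`; `xᵢ₀yⱼ₀/g = 1` and `xᵢyⱼ/g = (xᵢ/xᵢ₀)(yⱼ/yⱼ₀)`).
[folklore] -/
theorem segreChart_bijective (a b : ℕ) (i₀ : Fin a) (j₀ : Fin b) (g : ↥SR[a, b])
    (hg : (g : SP[a, b]) = X (Sum.inl i₀) * X (Sum.inr j₀))
    (ψ : MvPolynomial {v : Fin a ⊕ Fin b // v ≠ Sum.inl i₀} k →+* ↥(blowupAlgebra SM[a, b] g))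
    (hψC : ∀ c, (ψ (C c) : Localization.Away g) = AL[a, b, g] (algebraMap k (↥SR[a, b]) c))
    (hψg : (ψ (X ⟨Sum.inr j₀, Sum.inr_ne_inl⟩) : Localization.Away g) = AL[a, b, g] g)
    (hψx : ∀ (i : Fin a) (hi : (Sum.inl i : Fin a ⊕ Fin b) ≠ Sum.inl i₀),
      (ψ (X ⟨Sum.inl i, hi⟩) : Localization.Away g) = AL[a, b, g] SG[a, b, i, j₀] * IsLocalization.Away.invSelf g)
    (hψy : ∀ j : Fin b, j ≠ j₀ →
      (ψ (X ⟨Sum.inr j, Sum.inr_ne_inl⟩) : Localization.Away g) = AL[a, b, g] SG[a, b, i₀, j] * IsLocalization.Away.invSelf g) :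
    Function.Bijective ψ := by
  letI hAlg : Algebra (↥SR[a, b]) ↥(blowupAlgebra SM[a, b] g) := (blowupAlgebra SM[a, b] g).algebra
  -- `ψ` followed by the inclusion `A[SM/g] ⊆ A[1/g]`
  let φ : MvPolynomial {v : Fin a ⊕ Fin b // v ≠ Sum.inl i₀} k →+* Localization.Away g :=
    (blowupAlgebra SM[a, b] g).val.toRingHom.comp ψ
  have hφ : ∀ p, φ p = (ψ p : Localization.Away g) := fun p => rfl
  -- injectivity (torus embedding)
  have hφinj : Function.Injective φ :=
    segreChart_injective k a b i₀ j₀ g hg φ (fun c => (hφ _).trans (hψC c)) ((hφ _).trans hψg)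
      (fun i hi => (hφ _).trans (hψx i hi)) (fun j hj => (hφ _).trans (hψy j hj))
  refine ⟨fun p q hpq => hφinj ((hφ p).trans ((congrArg Subtype.val hpq).trans (hφ q).symm)), fun bb => ?_⟩
  -- surjectivity (generation): all the fractions `xᵢ/xᵢ₀`, `yⱼ/yⱼ₀` lie in the range (`xᵢ₀yⱼ₀/g = 1`)
  have hg' : g = SG[a, b, i₀, j₀] := Subtype.ext hg
  have hone : AL[a, b, g] SG[a, b, i₀, j₀] * IsLocalization.Away.invSelf g = 1 := by
    rw [← hg', IsLocalization.Away.mul_invSelf]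
  have hx : ∀ i : Fin a, AL[a, b, g] SG[a, b, i, j₀] * IsLocalization.Away.invSelf g ∈ φ.range := by
    intro i
    by_cases hi : i = i₀
    · subst hi
      rw [hone]
      exact φ.range.one_mem
    · exact RingHom.mem_range.mpr ⟨X ⟨Sum.inl i, fun e => hi (Sum.inl_injective e)⟩, (hφ _).trans (hψx i _)⟩
  have hy : ∀ j : Fin b, AL[a, b, g] SG[a, b, i₀, j] * IsLocalization.Away.invSelf g ∈ φ.range := by
    intro j
    by_cases hj : j = j₀
    · subst hj
      rw [hone]
      exact φ.range.one_mem
    · exact RingHom.mem_range.mpr ⟨X ⟨Sum.inr j, Sum.inr_ne_inl⟩, (hφ _).trans (hψy j hj)⟩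
  have hA : ∀ s, AL[a, b, g] s ∈ φ.range :=
    segreChart_algebraMap_mem k a b i₀ j₀ g hg φ.range (fun c => RingHom.mem_range.mpr ⟨_, (hφ _).trans (hψC c)⟩)
      (RingHom.mem_range.mpr ⟨_, (hφ _).trans hψg⟩) hx hy
  -- hence all the `xᵢyⱼ/g = (xᵢ/xᵢ₀)(yⱼ/yⱼ₀)` do, and the range is everything
  obtain ⟨p, hp⟩ := RingHom.mem_range.mp (segreChart_mem_of_mem_blowupAlgebra k a b g φ.range hA (fun v i j hv => by
    have hvu : AL[a, b, g] v * IsLocalization.Away.invSelf g = (AL[a, b, g] SG[a, b, i, j₀] * IsLocalization.Away.invSelf g) *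
        (AL[a, b, g] SG[a, b, i₀, j] * IsLocalization.Away.invSelf g) := by
      rw [segreChart_algebraMap_gen k a b i₀ j₀ g hg v i j hv]
      set f := AL[a, b, g]
      set u := IsLocalization.Away.invSelf (S := Localization.Away g) g
      have hinv : f g * u = 1 := IsLocalization.Away.mul_invSelf g
      calc f g * (f SG[a, b, i, j₀] * u) * (f SG[a, b, i₀, j] * u) * u
          = (f SG[a, b, i, j₀] * u) * (f SG[a, b, i₀, j] * u) * (f g * u) := by ring
        _ = (f SG[a, b, i, j₀] * u) * (f SG[a, b, i₀, j] * u) := by rw [hinv, mul_one]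
    rw [hvu]
    exact φ.range.mul_mem (hx i) (hy j)) bb.2)
  exact ⟨p, Subtype.ext hp⟩

/-- **THE CHART OF `Bl_{SM} C(ℙᵃ⁻¹ × ℙᵇ⁻¹)` AT `xᵢ₀yⱼ₀` IS AN AFFINE `(a+b-1)`-SPACE** (registered stub
`stub_segre_chart_isRegularRing`, crux stmt-ResolutionOfSingularities-15317, line `redirect`). The affine blowup algebra
`SR[a,b][SM/g] ⊆ SR[a,b][1/g]` of the vertex ideal of the Segre cone at the generator `g = xᵢ₀yⱼ₀` is a regular ring: the
parametrisation `ψ : k[T_v : v ≠ inl i₀] → SR[a,b][SM/g]`, `T_{inr j₀} ↦ g`, `T_{inl i} ↦ xᵢ/xᵢ₀ = (xᵢyⱼ₀)/g` (`i ≠ i₀`),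
`T_{inr j} ↦ yⱼ/yⱼ₀ = (xᵢ₀yⱼ)/g` (`j ≠ j₀`) (`MvPolynomial.eval₂Hom`, `div_mem_blowupAlgebra`) is bijective
(`segreChart_bijective`), so the chart is `k[g, xᵢ/xᵢ₀ (i ≠ i₀), yⱼ/yⱼ₀ (j ≠ j₀)] ≅ 𝔸^{a+b-1}`, regular by Mathlib's instance
for `MvPolynomial` over a field on a finite index type, moved along `IsRegularRing.of_ringEquiv`.
[folklore; Kollár 2007 §2.2 (blow-up of a vertex); Bruns–Herzog 1998 §6.1] -/
theorem stub_segre_chart_isRegularRing (a b : ℕ) (i₀ : Fin a) (j₀ : Fin b) (g : ↥SR[a, b])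
    (hg : (g : SP[a, b]) = MvPolynomial.X (Sum.inl i₀) * MvPolynomial.X (Sum.inr j₀)) :
    IsRegularRing ↥(blowupAlgebra SM[a, b] g) := by
  classical
  letI hAlg : Algebra (↥SR[a, b]) ↥(blowupAlgebra SM[a, b] g) := (blowupAlgebra SM[a, b] g).algebra
  -- the chart parametrisation `ψ : k[T_v : v ≠ inl i₀] → A[SM/g]`
  let F₀ : Fin a ⊕ Fin b → ↥(blowupAlgebra SM[a, b] g) :=
    Sum.elim (fun i => ⟨_, div_mem_blowupAlgebra _ g (segreChart_gen_mem_SM k a b i j₀)⟩)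
      (fun j => ⟨_, div_mem_blowupAlgebra _ g (segreChart_gen_mem_SM k a b i₀ j)⟩)
  let F : {v : Fin a ⊕ Fin b // v ≠ Sum.inl i₀} → ↥(blowupAlgebra SM[a, b] g) := fun v =>
    Function.update F₀ (Sum.inr j₀) (algebraMap (↥SR[a, b]) _ g) v.1
  let ψ : MvPolynomial {v : Fin a ⊕ Fin b // v ≠ Sum.inl i₀} k →+* ↥(blowupAlgebra SM[a, b] g) :=
    MvPolynomial.eval₂Hom ((algebraMap (↥SR[a, b]) _).comp (algebraMap k (↥SR[a, b]))) F
  have hψC : ∀ c, (ψ (C c) : Localization.Away g) = AL[a, b, g] (algebraMap k (↥SR[a, b]) c) := by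
    intro c
    simp only [ψ, MvPolynomial.coe_eval₂Hom, MvPolynomial.eval₂_C, RingHom.comp_apply]
    rfl
  have hψg : (ψ (X ⟨Sum.inr j₀, Sum.inr_ne_inl⟩) : Localization.Away g) = AL[a, b, g] g := by
    simp only [ψ, F, MvPolynomial.coe_eval₂Hom, MvPolynomial.eval₂_X, Function.update_self]
    rfl
  have hψx : ∀ (i : Fin a) (hi : (Sum.inl i : Fin a ⊕ Fin b) ≠ Sum.inl i₀),
      (ψ (X ⟨Sum.inl i, hi⟩) : Localization.Away g) = AL[a, b, g] SG[a, b, i, j₀] * IsLocalization.Away.invSelf g := by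
    intro i hi
    simp only [ψ, F, F₀, MvPolynomial.coe_eval₂Hom, MvPolynomial.eval₂_X, Function.update_of_ne Sum.inl_ne_inr, Sum.elim_inl]
  have hψy : ∀ j : Fin b, j ≠ j₀ →
      (ψ (X ⟨Sum.inr j, Sum.inr_ne_inl⟩) : Localization.Away g) = AL[a, b, g] SG[a, b, i₀, j] * IsLocalization.Away.invSelf g := by
    intro j hj
    have hne : (Sum.inr j : Fin a ⊕ Fin b) ≠ Sum.inr j₀ := fun e => hj (Sum.inr_injective e)
    simp only [ψ, F, F₀, MvPolynomial.coe_eval₂Hom, MvPolynomial.eval₂_X, Function.update_of_ne hne, Sum.elim_inr]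
  -- transport regularity of `k[T_v : v ≠ inl i₀]` along the ring isomorphism `ψ`
  exact IsRegularRing.of_ringEquiv (RingEquiv.ofBijective ψ (segreChart_bijective k a b i₀ j₀ g hg ψ hψC hψg hψx hψy))

end Cones

end Summit.ResolutionOfSingularities.ResolutionOfSingularities.Theorems.FRationalResolution

end
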